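import Summits.ResolutionOfSingularities.ResolutionOfSingularities.Theorems.FrobeniusLadderFRationalResolutionConeChainClosure
import HarnessLib

/-!
# Crux `FrobeniusLadder.FRationalResolution` (stmt-ResolutionOfSingularities-15317), line `redirect`,
# stub `stub_diagonalizableQuotientResolution` — **the initial cone: Hirzebruch–Jung chain of a rank-two
# cone; ALL first-round blow-up chart monoids are vertex charts** (brick C1 of memo MEMO-15317-leafhand2-g7,
# part 2 of 2; the part of the point-blow-up recursion for the SURFACE case over arbitrary fields that needs
# the Hilbert-basis chain; continues `…ConeChainClosure`)

Monoid combinatorics in `ℤⁿ` modulo a subgroup `L` (the unit-face group), `hQ`-membership currency of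
`…VertexChartMonoid`. A **rank-two cone in normal form** is `P = L + {m·u + l·e : l ≥ 0, a·l ≤ d·m}`,
`(u, e)` independent modulo `L`, `0 ≤ a < d` (the saturated cone between the rays `u` and `a u + d e`;
`a = 0` is the free cone). **`chain_exists`**: there is a finite `s ⊆ P ∖ L` (the Hirzebruch–Jung chain
`u = h₀, h₁, h₂, …`) generating `P ∖ L` over `P` such that EVERY chart monoid `⟨P ∪ (s − h)⟩`, `h ∈ s`
(`LogChart.blowupChartMonoid`), is a vertex chart monoid `L + {m v + l x : m ≥ 0, m + c l ≥ 0}` with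
`c ≤ 1 ∨ c + 2 ≤ d` (the chart at `u` is the end chart `L ⊕ ℕu ⊕ ℕ(h₁ − u)`, the chart at `h₁` has data
`(h₁, u − h₁)` and parameter `b₁ − 2`, `h₀ + h₂ = b₁ h₁`; deeper charts are those of the sub-cone between
`h₁` and `a u + d e`) — so `…VertexChartRegularity` / `…VertexChartSmallParameter` apply to the first
round as to all later ones, and the measure `d` drops by `2` at every singular point of the first blow-up.
Proof: Hirzebruch–Jung recursion `(d, a) ↦ (d − a, a mod (d − a))` in the basis `(u + e, e + t(u + e))`,
`t = ⌊a/(d − a)⌋`, by strong induction on `d`.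

Honest label: combinatorics toward ONE leaf stub (no stub, crux or summit closed). No definitions, no named
facts, no sorry. [cite: Kato1994, (10.1)] [cite: KempfEtAl1973, Ch. I §2] [cite: Niziol2006, §4]
-/

-- single-problem summit: the doubled namespace component is forced
set_option linter.dupNamespace false

open Summit.ResolutionOfSingularities.ResolutionOfSingularities.Theorems.FRationalResolution.VertexChartMonoid
open Summit.ResolutionOfSingularities.ResolutionOfSingularities.Theorems.FRationalResolution.ConeChainClosure

namespace Summit.ResolutionOfSingularities.ResolutionOfSingularities.Theorems.FRationalResolution.ConeChain

variable {n : ℕ} {L : Submodule ℤ (Fin n → ℤ)}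

/-! ### The Hirzebruch–Jung chain -/

/-- **The chain of a rank-two cone in normal form.** For `P = L + {m u + l e : l ≥ 0, a l ≤ d m}` with
`0 ≤ a < d` and `(u, e)` independent modulo `L`, and `nb` the neighbour of `u` in the chain (`e` if `a = 0`,
`u + e` if `a > 0`): there is a finite `s ⊆ P ∖ L` containing `u` and `nb` such that every element of
`P ∖ L` is an element of `s` plus an element of `P`; `u − nb` lies in every chart `⟨P ∪ (s − h)⟩`, `h ≠ u`;
the chart at `u` is `L ⊕ ℕu ⊕ ℕ(nb − u)`; and EVERY chart `⟨P ∪ (s − h)⟩`, `h ∈ s`, is a vertex chart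
monoid `L + {m v + l x : m ≥ 0, m + c l ≥ 0}` for data `(v, x)` independent modulo `L`, spanning what
`(u, e)` spans, with parameter `c ≤ 1` or `c + 2 ≤ d`. [cite: Kato1994, (10.1)] [cite: KempfEtAl1973, Ch. I §2] -/
theorem chain_exists (d : ℕ) :
    ∀ (a : ℕ), a < d → ∀ (P : AddSubmonoid (Fin n → ℤ)) (u e nb : Fin n → ℤ),
    (∀ g ∈ L, ∀ m l : ℤ, g + m • u + l • e = 0 → m = 0 ∧ l = 0) →
    (∀ w, w ∈ P ↔ ∃ g ∈ L, ∃ m l : ℤ, 0 ≤ l ∧ (a : ℤ) * l ≤ (d : ℤ) * m ∧ w = g + m • u + l • e) →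
    ((a = 0 ∧ nb = e) ∨ (0 < a ∧ nb = u + e)) →
    ∃ s : Set (Fin n → ℤ), s.Finite ∧ u ∈ s ∧ nb ∈ s ∧ (s ⊆ P) ∧ (∀ h ∈ s, h ∉ L) ∧
      (∀ p ∈ P, p ∉ L → ∃ h ∈ s, p - h ∈ P) ∧
      (∀ h ∈ s, h ≠ u →
        u - nb ∈ AddSubmonoid.closure ((P : Set (Fin n → ℤ)) ∪ (fun q => q - h) '' s)) ∧
      (∀ w, w ∈ AddSubmonoid.closure ((P : Set (Fin n → ℤ)) ∪ (fun q => q - u) '' s) ↔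
        ∃ g ∈ L, ∃ m l : ℤ, 0 ≤ m ∧ 0 ≤ l ∧ w = g + m • u + l • (nb - u)) ∧
      (∀ h ∈ s, ∃ v x : Fin n → ℤ, ∃ c : ℕ, (c ≤ 1 ∨ c + 2 ≤ d) ∧
        (∀ g ∈ L, ∀ m l : ℤ, g + m • v + l • x = 0 → m = 0 ∧ l = 0) ∧
        (∀ w : Fin n → ℤ, (∃ g ∈ L, ∃ m l : ℤ, w = g + m • u + l • e) →
          ∃ g ∈ L, ∃ m l : ℤ, w = g + m • v + l • x) ∧
        ∀ w, w ∈ AddSubmonoid.closure ((P : Set (Fin n → ℤ)) ∪ (fun q => q - h) '' s) ↔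
          ∃ g ∈ L, ∃ m l : ℤ, 0 ≤ m ∧ 0 ≤ m + (c : ℤ) * l ∧ w = g + m • v + l • x) := by
  induction d using Nat.strong_induction_on with
  | _ d IH => ?_
  intro a had P u e nb hind hP hnb
  have hdpos : (0 : ℤ) < d := by exact_mod_cast (show 0 < d by omega)
  have hgP : ∀ g ∈ L, g ∈ P := fun g hg => (hP g).2 ⟨g, hg, 0, 0, le_rfl, by simp, by simp⟩
  have hm0 : ∀ {m l : ℤ}, 0 ≤ l → (a : ℤ) * l ≤ (d : ℤ) * m → 0 ≤ m := by
    intro m l hl h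
    exact nonneg_of_mul_nonneg_pos hdpos ((mul_nonneg (by positivity) hl).trans h)
  have huP : u ∈ P := (hP u).2 ⟨0, L.zero_mem, 1, 0, le_rfl, by simp, by simp⟩
  have huL : u ∉ L := by
    rw [show u = 0 + (1 : ℤ) • u + (0 : ℤ) • e by simp, mem_L_iff hind L.zero_mem]; omega
  rcases hnb with ⟨ha0, hnb⟩ | ⟨ha0, hnb⟩
  · /- BASE: the free cone `L ⊕ ℕu ⊕ ℕe`, chain `{u, e}` -/
    subst ha0; subst nb
    have hP0 : ∀ w, w ∈ P ↔ ∃ g ∈ L, ∃ m l : ℤ, 0 ≤ m ∧ 0 ≤ l ∧ w = g + m • u + l • e := by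
      intro w
      rw [hP w]
      constructor
      · rintro ⟨g, hg, m, l, hl, hml, rfl⟩; exact ⟨g, hg, m, l, hm0 hl hml, hl, rfl⟩
      · rintro ⟨g, hg, m, l, hm, hl, rfl⟩; exact ⟨g, hg, m, l, hl, by push_cast; nlinarith, rfl⟩
    have heP : e ∈ P := (hP0 e).2 ⟨0, L.zero_mem, 0, 1, le_rfl, by norm_num, by simp⟩
    have heL : e ∉ L := by
      rw [show e = 0 + (0 : ℤ) • u + (1 : ℤ) • e by simp, mem_L_iff hind L.zero_mem]; omega
    refine ⟨{u, e}, (Set.finite_singleton e).insert u, by simp, by simp, ?_, ?_, ?_, ?_, ?_, ?_⟩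
    · intro h hh  -- `s ⊆ P`
      rcases hh with hh | hh
      · subst h; exact huP
      · rw [Set.mem_singleton_iff] at hh; subst h; exact heP
    · intro h hh  -- `s ∩ L = ∅`
      rcases hh with hh | hh
      · subst h; exact huL
      · rw [Set.mem_singleton_iff] at hh; subst h; exact heL
    · intro p hp hpL  -- generation
      obtain ⟨g, hg, m, l, hm, hl, rfl⟩ := (hP0 p).1 hp
      rw [mem_L_iff hind hg] at hpL
      rcases le_or_gt 1 m with h1 | h1
      · refine ⟨u, by simp, (hP0 _).2 ⟨g, hg, m - 1, l, by omega, hl, by module⟩⟩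
      · refine ⟨e, by simp, (hP0 _).2 ⟨g, hg, m, l - 1, hm, by omega, by module⟩⟩
    · intro h hh hne  -- `u − nb` in the other charts
      rcases hh with hh | hh
      · exact absurd hh hne
      · rw [Set.mem_singleton_iff] at hh; subst h
        exact AddSubmonoid.subset_closure (Or.inr ⟨u, by simp, rfl⟩)
    · intro w  -- the end chart at `u`
      apply mem_closure_iff_free
      · rintro z (hz | ⟨q, hq, rfl⟩)
        · obtain ⟨g, hg, m, l, hm, hl, rfl⟩ := (hP0 z).1 hz
          exact ⟨g, hg, m + l, l, by omega, hl, by module⟩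
        · dsimp only
          rcases hq with hq | hq
          · subst q; exact ⟨0, L.zero_mem, 0, 0, le_rfl, le_rfl, by simp⟩
          · rw [Set.mem_singleton_iff] at hq; subst q
            exact ⟨0, L.zero_mem, 0, 1, le_rfl, by norm_num, by simp⟩
      · exact fun g hg => AddSubmonoid.subset_closure (Or.inl (hgP g hg))
      · exact AddSubmonoid.subset_closure (Or.inl huP)
      · exact AddSubmonoid.subset_closure (Or.inr ⟨e, by simp, rfl⟩)
    · intro h hh  -- every chart is a vertex chart with parameter `1`
      rcases hh with hh | hh
      · -- chart at `u`: data `(e, u)`, parameter `1`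
        subst h
        refine ⟨e, u, 1, Or.inl le_rfl, ?_, ?_, ?_⟩
        · intro g hg m l hz
          have := hind g hg l m (by rw [← hz]; module); exact ⟨this.2, this.1⟩
        · rintro w ⟨g, hg, m, l, rfl⟩; exact ⟨g, hg, l, m, by module⟩
        · intro w
          apply mem_closure_iff_vertex
          · rintro z (hz | ⟨q, hq, rfl⟩)
            · obtain ⟨g, hg, m, l, hm, hl, rfl⟩ := (hP0 z).1 hz
              exact ⟨g, hg, l, m, hl, by push_cast; omega, by module⟩
            · dsimp only
              rcases hq with hq | hq
              · subst q; exact ⟨0, L.zero_mem, 0, 0, le_rfl, by simp, by simp⟩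
              · rw [Set.mem_singleton_iff] at hq; subst q
                exact ⟨0, L.zero_mem, 1, -1, by norm_num, by norm_num, by module⟩
          · exact fun g hg => AddSubmonoid.subset_closure (Or.inl (hgP g hg))
          · exact AddSubmonoid.subset_closure (Or.inl heP)
          · exact AddSubmonoid.subset_closure (Or.inl huP)
          · rw [Nat.cast_one, one_smul]
            exact AddSubmonoid.subset_closure (Or.inr ⟨e, by simp, rfl⟩)
      · -- chart at `e`: data `(u, e)`, parameter `1`
        rw [Set.mem_singleton_iff] at hh; subst h
        refine ⟨u, e, 1, Or.inl le_rfl, hind, fun w hw => hw, ?_⟩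
        intro w
        apply mem_closure_iff_vertex
        · rintro z (hz | ⟨q, hq, rfl⟩)
          · obtain ⟨g, hg, m, l, hm, hl, rfl⟩ := (hP0 z).1 hz
            exact ⟨g, hg, m, l, hm, by push_cast; omega, rfl⟩
          · dsimp only
            rcases hq with hq | hq
            · subst q; exact ⟨0, L.zero_mem, 1, -1, by norm_num, by norm_num, by module⟩
            · rw [Set.mem_singleton_iff] at hq; subst q
              exact ⟨0, L.zero_mem, 0, 0, le_rfl, by simp, by simp⟩
        · exact fun g hg => AddSubmonoid.subset_closure (Or.inl (hgP g hg))
        · exact AddSubmonoid.subset_closure (Or.inl huP)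
        · exact AddSubmonoid.subset_closure (Or.inl heP)
        · rw [Nat.cast_one, one_smul]
          exact AddSubmonoid.subset_closure (Or.inr ⟨u, by simp, rfl⟩)
  · /- STEP: `0 < a < d`, Hirzebruch–Jung recursion `(d, a) ↦ (d − a, a mod (d − a))` -/
    subst nb
    obtain ⟨d', hdd', hd'⟩ : ∃ d' : ℕ, d = a + d' ∧ 0 < d' := ⟨d - a, by omega, by omega⟩
    obtain ⟨t, r, htr, hr⟩ : ∃ t r : ℕ, d' * t + r = a ∧ r < d' :=
      ⟨a / d', a % d', Nat.div_add_mod a d', Nat.mod_lt a hd'⟩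
    have ha_cast : (a : ℤ) = (d' : ℤ) * t + r := by exact_mod_cast htr.symm
    have hd_cast : (d : ℤ) = (a : ℤ) + d' := by exact_mod_cast hdd'
    have hd'pos : (0 : ℤ) < d' := by exact_mod_cast hd'
    -- the new basis `(h₁, e') = (u + e, e + t (u + e))`
    obtain ⟨h₁, hh₁⟩ : ∃ h₁ : Fin n → ℤ, h₁ = u + e := ⟨_, rfl⟩
    obtain ⟨e', he'⟩ : ∃ e' : Fin n → ℤ, e' = e + (t : ℤ) • h₁ := ⟨_, rfl⟩
    have conv : ∀ m l : ℤ, m • h₁ + l • e' = (m + t * l) • u + (m + l + t * l) • e := by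
      intro m l; rw [he', hh₁]; module
    have conv' : ∀ m l : ℤ, m • u + l • e = (m - t * (l - m)) • h₁ + (l - m) • e' := by
      intro m l; rw [he', hh₁]; module
    have hue : u = h₁ + -e := by rw [hh₁]; abel
    have hind₁ : ∀ g ∈ L, ∀ m l : ℤ, g + m • h₁ + l • e' = 0 → m = 0 ∧ l = 0 := by
      intro g hg m l h
      rw [add_assoc, conv, ← add_assoc] at h
      obtain ⟨h1, h2⟩ := hind g hg _ _ h
      have hl : l = 0 := by linarith
      subst hl
      simp only [mul_zero, add_zero] at h1; exact ⟨h1, rfl⟩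
    -- the sub-cone between `h₁` and `a u + d e = r h₁ + d' e'`
    obtain ⟨P', hP'⟩ := exists_cone L h₁ e' r d'
    have key : ∀ m l : ℤ, (d' : ℤ) * (m - t * (l - m)) - r * (l - m) = d * m - a * l := by
      intro m l; rw [hd_cast, ha_cast]; ring
    have key' : ∀ m l : ℤ, (d : ℤ) * (m + t * l) - a * (m + l + t * l) = d' * m - r * l := by
      intro m l; rw [hd_cast, ha_cast]; ring
    have hP'P : ∀ w ∈ P', w ∈ P := by
      intro w hw
      obtain ⟨g, hg, m, l, hl, hrl, rfl⟩ := (hP' w).1 hw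
      have hm : 0 ≤ m := nonneg_of_mul_nonneg_pos hd'pos ((mul_nonneg (by positivity) hl).trans hrl)
      refine (hP _).2 ⟨g, hg, m + t * l, m + l + t * l, by positivity, ?_, by rw [add_assoc, conv, ← add_assoc]⟩
      have := key' m l; linarith
    have hmemP' : ∀ g ∈ L, ∀ m l : ℤ, 0 ≤ l → (a : ℤ) * l ≤ (d : ℤ) * m → m ≤ l →
        g + m • u + l • e ∈ P' := by
      intro g hg m l hl hml hle
      refine (hP' _).2 ⟨g, hg, m - t * (l - m), l - m, by omega, ?_, by rw [add_assoc, conv', ← add_assoc]⟩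
      have := key m l; linarith
    have hdecomp : ∀ p ∈ P, ∃ p' ∈ P', ∃ k : ℕ, p = p' + k • u := by
      intro p hp
      obtain ⟨g, hg, m, l, hl, hml, rfl⟩ := (hP p).1 hp
      rcases le_or_gt m l with hle | hlt
      · exact ⟨_, hmemP' g hg m l hl hml hle, 0, by simp⟩
      · refine ⟨g + l • h₁, (hP' _).2 ⟨g, hg, l, 0, le_rfl, by positivity, by simp⟩, (m - l).toNat, ?_⟩
        rw [← natCast_zsmul u, Int.toNat_of_nonneg (by omega : 0 ≤ m - l), hh₁]
        module
    have hh₁P' : h₁ ∈ P' := (hP' h₁).2 ⟨0, L.zero_mem, 1, 0, le_rfl, by simp, by simp⟩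
    have hh₁P : h₁ ∈ P := hP'P h₁ hh₁P'
    -- the neighbour of `h₁` in the sub-cone and the parameter `c₁` of the chart at `h₁`
    obtain ⟨nb', hnb'⟩ : ∃ nb' : Fin n → ℤ, (r = 0 ∧ nb' = e') ∨ (0 < r ∧ nb' = h₁ + e') := by
      rcases Nat.eq_zero_or_pos r with h | h
      exacts [⟨e', Or.inl ⟨h, rfl⟩⟩, ⟨h₁ + e', Or.inr ⟨h, rfl⟩⟩]
    obtain ⟨c₁, hc₁, hc₁d⟩ : ∃ c₁ : ℕ, nb' - h₁ = (c₁ : ℤ) • h₁ + e ∧ (c₁ ≤ 1 ∨ c₁ + 2 ≤ d) := by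
      rcases hnb' with ⟨hr0, rfl⟩ | ⟨hr0, rfl⟩
      · subst hr0
        have ht : 1 ≤ t := by
          rcases Nat.eq_zero_or_pos t with h | h
          · subst h; simp at htr; omega
          exact h
        have ht' : t ≤ d' * t := Nat.le_mul_of_pos_left t hd'
        refine ⟨t - 1, ?_, Or.inr (by omega)⟩
        rw [Nat.cast_sub ht, Nat.cast_one, he']; module
      · have hd'2 : 2 * t ≤ d' * t := Nat.mul_le_mul_right t (by omega)
        refine ⟨t, by rw [he']; module, ?_⟩
        rcases le_or_gt t 1 with h | h
        exacts [Or.inl h, Or.inr (by omega)]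
    have hnb'eq : nb' = (c₁ : ℤ) • h₁ + e + h₁ := by rw [← hc₁]; abel
    -- induction hypothesis for the sub-cone
    obtain ⟨s', hs'fin, hh₁s', hnb's', hs'P', hs'L, hgen', hv', hend', hchart'⟩ :=
      IH d' (by omega) r hr P' h₁ e' nb' hind₁ hP' hnb'
    have hnegE : ∀ h ∈ s', h ≠ h₁ →
        -e ∈ AddSubmonoid.closure ((P' : Set (Fin n → ℤ)) ∪ (fun q => q - h) '' s') := by
      intro h hh hne
      have e1 : -e = (h₁ - nb') + c₁ • h₁ := by
        rw [← natCast_zsmul h₁ c₁, hnb'eq]; module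
      rw [e1]
      refine AddSubmonoid.add_mem _ (hv' h hh hne) (AddSubmonoid.nsmul_mem _ ?_ _)
      exact AddSubmonoid.subset_closure (Or.inl hh₁P')
    have huC' : ∀ h ∈ s', h ≠ h₁ →
        u ∈ AddSubmonoid.closure ((P' : Set (Fin n → ℤ)) ∪ (fun q => q - h) '' s') := by
      intro h hh hne
      rw [hue]
      exact AddSubmonoid.add_mem _ (AddSubmonoid.subset_closure (Or.inl hh₁P')) (hnegE h hh hne)
    have hCC' : ∀ h ∈ s', h ≠ h₁ →
        AddSubmonoid.closure ((P : Set (Fin n → ℤ)) ∪ (fun q => q - h) '' insert u s') =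
          AddSubmonoid.closure ((P' : Set (Fin n → ℤ)) ∪ (fun q => q - h) '' s') := by
      intro h hh hne
      apply le_antisymm
      · rw [AddSubmonoid.closure_le]
        rintro z (hz | ⟨q, hq, rfl⟩)
        · obtain ⟨p', hp', k, rfl⟩ := hdecomp z hz
          exact AddSubmonoid.add_mem _ (AddSubmonoid.subset_closure (Or.inl hp'))
            (AddSubmonoid.nsmul_mem _ (huC' h hh hne) k)
        · dsimp only
          rcases (Set.mem_insert_iff.1 hq) with hqu | hq'
          · rw [hqu, show u - h = (h₁ - h) + -e by rw [hh₁]; abel]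
            refine AddSubmonoid.add_mem _ ?_ (hnegE h hh hne)
            exact AddSubmonoid.subset_closure (Or.inr ⟨h₁, hh₁s', rfl⟩)
          · exact AddSubmonoid.subset_closure (Or.inr ⟨q, hq', rfl⟩)
      · exact AddSubmonoid.closure_mono
          (Set.union_subset_union (fun w hw => hP'P w hw) (Set.image_mono (Set.subset_insert _ _)))
    -- coordinates of the elements of `s'`: `u`-coordinate at least `1`
    have hs'coord : ∀ q ∈ s', ∃ g ∈ L, ∃ m l : ℤ, 1 ≤ m ∧ 0 ≤ l ∧ (a : ℤ) * l ≤ (d : ℤ) * m ∧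
        q = g + m • u + l • e := by
      intro q hq
      obtain ⟨g, hg, m, l, hl, hml, hqe⟩ := (hP q).1 (hP'P q (hs'P' hq))
      have hm := hm0 hl hml
      refine ⟨g, hg, m, l, ?_, hl, hml, hqe⟩
      by_contra hlt
      have hm00 : m = 0 := by omega
      subst hm00
      have hl0 : l = 0 := by
        have ha0' : (0 : ℤ) < a := by exact_mod_cast ha0
        nlinarith
      subst hl0
      exact hs'L q hq (by rw [hqe, mem_L_iff hind hg]; exact ⟨rfl, rfl⟩)
    -- the end chart at `u`
    have hend : ∀ w, w ∈ AddSubmonoid.closure ((P : Set (Fin n → ℤ)) ∪ (fun q => q - u) '' insert u s') ↔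
        ∃ g ∈ L, ∃ m l : ℤ, 0 ≤ m ∧ 0 ≤ l ∧ w = g + m • u + l • e := by
      intro w
      apply mem_closure_iff_free
      · rintro z (hz | ⟨q, hq, rfl⟩)
        · obtain ⟨g, hg, m, l, hl, hml, rfl⟩ := (hP z).1 hz
          exact ⟨g, hg, m, l, hm0 hl hml, hl, rfl⟩
        · dsimp only
          rcases (Set.mem_insert_iff.1 hq) with hqu | hq'
          · rw [hqu, sub_self]; exact ⟨0, L.zero_mem, 0, 0, le_rfl, le_rfl, by simp⟩
          · obtain ⟨g, hg, m, l, hm, hl, -, rfl⟩ := hs'coord q hq'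
            exact ⟨g, hg, m - 1, l, by omega, hl, by module⟩
      · exact fun g hg => AddSubmonoid.subset_closure (Or.inl (hgP g hg))
      · exact AddSubmonoid.subset_closure (Or.inl huP)
      · rw [show e = h₁ - u by rw [hh₁]; abel]
        exact AddSubmonoid.subset_closure (Or.inr ⟨h₁, Set.mem_insert_of_mem _ hh₁s', rfl⟩)
    refine ⟨insert u s', hs'fin.insert u, Set.mem_insert _ _, ?_, ?_, ?_, ?_, ?_, ?_, ?_⟩
    · -- `nb = h₁ ∈ s`
      rw [← hh₁]; exact Set.mem_insert_of_mem _ hh₁s'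
    · -- `s ⊆ P`
      exact Set.insert_subset huP (fun q hq => hP'P q (hs'P' hq))
    · -- `s ∩ L = ∅`
      intro h hh
      rcases (Set.mem_insert_iff.1 hh) with hh | hh
      · subst h; exact huL
      · exact hs'L h hh
    · -- generation of `P ∖ L`
      intro p hp hpL
      obtain ⟨g, hg, m, l, hl, hml, rfl⟩ := (hP p).1 hp
      rcases le_or_gt m l with hle | hlt
      · obtain ⟨h, hh, hph⟩ := hgen' _ (hmemP' g hg m l hl hml hle) hpL
        exact ⟨h, Set.mem_insert_of_mem _ hh, hP'P _ hph⟩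
      · refine ⟨u, Set.mem_insert _ _, (hP _).2 ⟨g, hg, m - 1, l, hl, ?_, by module⟩⟩
        have h1 : (a : ℤ) * l ≤ (a : ℤ) * (m - 1) := mul_le_mul_of_nonneg_left (by omega) (by positivity)
        have h2 : (a : ℤ) * (m - 1) ≤ (d : ℤ) * (m - 1) :=
          mul_le_mul_of_nonneg_right (by exact_mod_cast had.le) (by omega)
        exact h1.trans h2
    · -- `u − nb = −e` lies in every other chart
      intro h hh hne
      rcases (Set.mem_insert_iff.1 hh) with hh | hh
      · exact absurd hh hne
      · rw [show u - (u + e) = -e by abel]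
        by_cases hh1 : h = h₁
        · subst hh1
          rw [show -e = u - h by rw [hh₁]; abel]
          exact AddSubmonoid.subset_closure (Or.inr ⟨u, Set.mem_insert _ _, rfl⟩)
        · exact AddSubmonoid.closure_mono
            (Set.union_subset_union (fun w hw => hP'P w hw) (Set.image_mono (Set.subset_insert _ _)))
            (hnegE h hh hh1)
    · -- the end chart at `u`: `L ⊕ ℕu ⊕ ℕe`
      intro w
      rw [add_sub_cancel_left]
      exact hend w
    · -- every chart is a vertex chart
      intro h hh
      rcases (Set.mem_insert_iff.1 hh) with hh | hh
      · -- chart at `u`: data `(h₁, u)`, parameter `1`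
        subst h
        refine ⟨h₁, u, 1, Or.inl le_rfl, ?_, ?_, ?_⟩
        · intro g hg m l hz
          have := hind g hg (m + l) m (by rw [← hz, hh₁]; module)
          omega
        · rintro w ⟨g, hg, m, l, rfl⟩
          exact ⟨g, hg, l, m - l, by rw [hh₁]; module⟩
        · intro w
          rw [hend w]
          constructor
          · rintro ⟨g, hg, M, Λ, hM, hΛ, rfl⟩
            exact ⟨g, hg, Λ, M - Λ, hΛ, by push_cast; omega, by rw [hh₁]; module⟩
          · rintro ⟨g, hg, m, l, hm, hml, rfl⟩
            exact ⟨g, hg, m + l, m, by push_cast at hml; omega, hm, by rw [hh₁]; module⟩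
      · by_cases hh1 : h = h₁
        · -- chart at `h₁`: data `(h₁, −e)`, parameter `c₁`
          subst hh1
          refine ⟨h, -e, c₁, hc₁d, ?_, ?_, ?_⟩
          · intro g hg m l hz
            have := hind g hg m (m - l) (by rw [← hz, hh₁]; module)
            omega
          · rintro w ⟨g, hg, m, l, rfl⟩
            exact ⟨g, hg, m, m - l, by rw [hh₁]; module⟩
          · intro w
            have hy : (c₁ : ℤ) • h - -e = nb' - h := by rw [hc₁]; abel
            apply mem_closure_iff_vertex
            · rintro z (hz | ⟨q, hq, rfl⟩)
              · obtain ⟨p', hp', k, rfl⟩ := hdecomp z hz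
                obtain ⟨g, hg, M, Λ, hM, hΛ, hp'eq⟩ :=
                  (hend' p').1 (AddSubmonoid.subset_closure (Or.inl hp'))
                obtain ⟨g', hg', m, l, hm, hml, heq⟩ :=
                  three_coords h (-e) g c₁ (show 0 ≤ M + k by positivity) (show (0 : ℤ) ≤ k by positivity) hΛ hg
                refine ⟨g', hg', m, l, hm, hml, ?_⟩
                rw [← heq, hy, hp'eq, ← natCast_zsmul u k, hue]
                module
              · dsimp only
                rcases (Set.mem_insert_iff.1 hq) with hqu | hq'
                · refine ⟨0, L.zero_mem, 0, 1, le_rfl, by simp, ?_⟩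
                  rw [hqu, hue]; module
                · obtain ⟨g, hg, M, Λ, hM, hΛ, hqeq⟩ :=
                    (hend' (q - h)).1 (AddSubmonoid.subset_closure (Or.inr ⟨q, hq', rfl⟩))
                  obtain ⟨g', hg', m, l, hm, hml, heq⟩ :=
                    three_coords h (-e) g c₁ hM le_rfl hΛ hg
                  refine ⟨g', hg', m, l, hm, hml, ?_⟩
                  rw [← heq, hy, hqeq]
                  module
            · exact fun g hg => AddSubmonoid.subset_closure (Or.inl (hgP g hg))
            · exact AddSubmonoid.subset_closure (Or.inl hh₁P)
            · rw [show -e = u - h by rw [hh₁]; abel]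
              exact AddSubmonoid.subset_closure (Or.inr ⟨u, Set.mem_insert _ _, rfl⟩)
            · rw [hy]
              exact AddSubmonoid.subset_closure
                (Or.inr ⟨nb', Set.mem_insert_of_mem _ hnb's', rfl⟩)
        · -- deeper charts: those of the sub-cone
          obtain ⟨v, x, c, hcd, hindvx, hspanvx, hiff⟩ := hchart' h hh
          refine ⟨v, x, c, ?_, hindvx, ?_, fun w => by rw [hCC' h hh hh1]; exact hiff w⟩
          · rcases hcd with hcd | hcd
            · exact Or.inl hcd
            · exact Or.inr (by omega)
          · rintro w ⟨g, hg, m, l, rfl⟩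
            exact hspanvx _ ⟨g, hg, m - t * (l - m), l - m, by rw [add_assoc, conv', ← add_assoc]⟩

end Summit.ResolutionOfSingularities.ResolutionOfSingularities.Theorems.FRationalResolution.ConeChain
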